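import Summits.QuantumFields.YangMills.Theorems.IR.Negative.OnsetMixingTypicalFalseOfMassWire
import Summits.QuantumFields.YangMills.Theorems.IR.Negative.OuterCertFalseOfWire
import Literature.MathematicalPhysics.QuantumLattice.LatticeGaugeDLRProofs

/-!
# `¬ OnsetMixing` modulo a uniform / central-face wire, and the central kernel symmetry
(Q-g18 disprove lineage, g3; owner rulings R23 (iii) / R28 «standing Negative asks `OnsetMixingFalseOfUniformWire.lean`,
`CentralFaceWire.lean`» — both discharged here; Negative lane of crux `BalabanLadder.IR`, item stmt-QuantumFields-19354)

The EXPIRED crux-plan cut `af-pincer` g0 (skeleton sha16 022967c699dbe563; stub `stub_onset : OnsetMixing`, expired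
2026-08-27T02:23:44Z when the hedge cut `af-pincer-T` 0308f95ca6f6a115 was registered) is mirrored verbatim in the
sibling module `OnsetMixingTypicalFalseOfMassWire` (`OnsetFormats.UnivShellCond`, `.mixSet`, `.mixOnset`, `.OnsetMixing`),
which also records that the registered stub `OnsetMixingTypical` is a weakening of `OnsetMixing` and types ITS bet
(`MassWire`).  This module records why the g0 format was abandoned (kernel-checked, no `sorry`; hypotheses H are
`def … : Prop`, never asserted):

* `not_onsetMixing_of_uniformWire` / `…SU2` — the UNIFORM wire `UniformWire r.ρ` (ctriage-1's `FaceCoexistence` shape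
  from mesh `1`; cplan-af-pincer g3 rev 3 §4′, whose proofs are reproduced) for ONE lattice representation of ONE compact
  simple `G` refutes `OnsetMixing` outright — no `NT`, no `LowerBounds`, no `[1, b₀)` corner: `mixSet = ∅` and
  `mixOnset = 0` at every large `β` (`mixSet_eq_empty_of_uniformWire`), through the LANDED
  `OuterCertWire.not_outerTemperedCond_of_wireAt` and `univToOuter` (`UnivShellCond` is v10's outer-tempered condition
  with `Good ≡ univ`).
* certideate-2 g4's `CentralFaceWire` (card `central-sign-frustrated-face`: a frozen cell face of CENTRAL links `±1 ∈ SU(2)`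
  in a fully frustrated sign pattern, a 3-D `SO(3)`-breaking boundary magnet selected by one rim cell) is `UniformWire`
  with `δ > 0` (`uniformWire_of_centralFaceWire`) and `BoundaryOrderWire` with `b₀ = 1`
  (`boundaryOrderWire_of_centralFaceWire`); hence `not_onsetMixing_of_centralFaceWireSU2`.
* `centralKernelInvariance` (PROVED; the card's «first lemma»): with boundary data CENTRAL off the resampled edge set the
  Wilson kernel is exactly invariant under global conjugation — the tree's gauge covariance
  `ymSpecification_map_gaugeTransformZd_holds` at the constant gauge function plus kernel congruence off `Λ`
  (`ShellTempered.ymSpecification_congr_off`).  The card's T = 0 canting lemma and the 3-D boundary long-range order that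
  would make `CentralFaceWire` a THEOREM are NOT proved (owner R37 (c): continuous-symmetry boundary LRO needed; bond-plane
  RP obstructed; kit census j264886/j265356/j267092 of certideate-2 is numerics about the premise only).
* These sup-`ζ` wires do NOT bite the registered format T (see the sibling module's header): the verdict for the
  registered cut is NOT-REFUTED (memo `pub/ym-beyond/ym-19354-disprove-1/NOT-REFUTED.md` §8).
-/

noncomputable section

open Filter Topology MeasureTheory
open Literature.MathematicalPhysics.QuantumFieldTheory Literature.MathematicalPhysics.QuantumLattice
open Literature.Probability.LatticeModels
open Summit.QuantumFields.YangMills.Cruxes.IR.Tempered (cellEdges windowCells regionEdges)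
open Summit.QuantumFields.YangMills.Cruxes.IR.ShellTempered (windowCellsPlus ymSpecification_congr_off)
open Summit.QuantumFields.YangMills.Cruxes.IR.OuterCertWire (OuterTemperedCond WireAt BoundaryOrderWire
  not_outerTemperedCond_of_wireAt)
open Summit.QuantumFields.YangMills.Cruxes.IR.OnsetFormats (shellCount UnivShellCond mixSet mixOnset OnsetMixing
  eps_lt_third_of_admissible)

namespace Summit.QuantumFields.YangMills.Cruxes.IR.OnsetWire

/-! ## §1 `UnivShellCond` is v10's outer-tempered condition with `Good ≡ univ` -/

section Univ

variable {G : Type} [Group G] [TopologicalSpace G] [IsTopologicalGroup G] [CompactSpace G]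
  [MeasurableSpace G] [BorelSpace G]

/-- mirror of `AfPincer.univToOuter` (g0 :132, PROVED): the untempered condition is v10's outer-tempered condition
with `Good ≡ univ` (stated for the tree copy `OuterCertWire.OuterTemperedCond`, definitionally v10's). -/
theorem univToOuter {N : ℕ} (ρ : G →* Matrix (Fin N) (Fin N) ℂ) (β : ℝ) (b n : ℕ) (ε δ : ℝ)
    (hU : UnivShellCond ρ β b n ε) : OuterTemperedCond ρ β b n ε δ := by
  intro w hw
  refine ⟨fun _ => Set.univ, fun _ => MeasurableSet.univ, ?_, ?_, ?_⟩
  · intro c x y _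
    simp
  · intro Y hY h0 σ σ' hpair f hf hfm hf01
    refine hU w hw Y hY h0 σ σ' ?_ f hf hfm hf01
    intro c hc hcY hcW e he
    rcases hpair c hc hcY with h | ⟨hnot, -, -⟩
    · exact h e he
    · exact absurd hcW hnot
  · intro c E' _ ζ
    simp

end Univ

/-! ## §2 The uniform wire and the central-face wire kill the g0 stub -/

section Wires

variable {G : Type} [Group G] [TopologicalSpace G] [IsTopologicalGroup G] [CompactSpace G]
  [MeasurableSpace G] [BorelSpace G]

/-- **Uniform wire** (cplan-af-pincer rev 3 §4′; hypothesis shape of ctriage-1's `FaceCoexistence`, from mesh `1`,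
any real `δ`): one kernel-mass level `δ` and ONE threshold `β₀`, uniform in the mesh, beyond which every mesh `b ≥ 1`
and every window radius `n ≥ 1` carry the LANDED wire `OuterCertWire.WireAt`.  Physical content: a boundary-selected
coexistence of tuned-wall surface states persisting at EVERY mesh on a half-line of couplings. -/
def UniformWire {N : ℕ} (ρ : G →* Matrix (Fin N) (Fin N) ℂ) : Prop :=
  ∃ (δ β₀ : ℝ), ∀ β : ℝ, β₀ ≤ β → ∀ b : ℕ, 1 ≤ b → ∀ n : ℕ, 1 ≤ n → WireAt ρ β b n δ

/-- **Central-face wire** (certideate-2 g4, card `central-sign-frustrated-face`): one rarity budget `δ > 0` and one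
threshold `β₀` such that `WireAt ρ β b n δ` holds for every `β ≥ β₀`, every mesh `b ≥ 1` and every window `n ≥ 1`
(intended witness: a frozen cell face whose links are CENTRAL, `±1 ∈ SU(2)`, in a fully frustrated sign pattern; the
pinned layer is a 3-D `SO(3)`-breaking boundary magnet whose orientation one rim cell selects). -/
def CentralFaceWire {N : ℕ} (ρ : G →* Matrix (Fin N) (Fin N) ℂ) : Prop :=
  ∃ δ : ℝ, 0 < δ ∧ ∃ β₀ : ℝ, ∀ β : ℝ, β₀ ≤ β → ∀ b n : ℕ, 1 ≤ b → 1 ≤ n → WireAt ρ β b n δ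

/-- `CentralFaceWire` is a `UniformWire` (forget `0 < δ`). -/
theorem uniformWire_of_centralFaceWire {N : ℕ} {ρ : G →* Matrix (Fin N) (Fin N) ℂ} (hW : CentralFaceWire ρ) :
    UniformWire ρ := by
  obtain ⟨δ, _, β₀, h⟩ := hW
  exact ⟨δ, β₀, fun β hβ b hb n hn => h β hβ b n hb hn⟩

/-- `CentralFaceWire` is `BoundaryOrderWire` with `b₀ = 1` (so the landed `outerCertificate_false_of_wire` and
`irOuterCertificate_false_of_nt_of_wireSU2` apply to it). -/
theorem boundaryOrderWire_of_centralFaceWire {N : ℕ} {ρ : G →* Matrix (Fin N) (Fin N) ℂ}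
    (hW : CentralFaceWire ρ) : BoundaryOrderWire ρ := by
  obtain ⟨δ, hδ, β₀, h⟩ := hW
  exact ⟨δ, hδ, 1, β₀, fun b hb β hβ n hn => h β hβ b n hb hn⟩

/-- A wire at mesh `b` kills untempered mixing at mesh `b` for every `ε < 1/3` (through the landed
`not_outerTemperedCond_of_wireAt` and `univToOuter`). -/
theorem not_univShellCond_of_wireAt {N : ℕ} {ρ : G →* Matrix (Fin N) (Fin N) ℂ} {β : ℝ} {b n : ℕ} {ε δ : ℝ}
    (hW : WireAt ρ β b n δ) (hε : ε < 1 / 3) : ¬ UnivShellCond ρ β b n ε := fun hU =>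
  not_outerTemperedCond_of_wireAt hW hε (univToOuter ρ β b n ε δ hU)

/-- **Under a uniform wire the mixing set is EMPTY and the onset is the junk value `0` at every large coupling**,
for every admissible `(n, ε)` — no `[1, b₀)` corner survives (contrast `BoundaryOrderWire`, `b ≥ b₀`). -/
theorem mixSet_eq_empty_of_uniformWire {N : ℕ} {ρ : G →* Matrix (Fin N) (Fin N) ℂ} (hW : UniformWire ρ)
    {n : ℕ} {ε : ℝ} (hn : 1 ≤ n) (hM : ε * shellCount n < 1) :
    ∃ β₀ : ℝ, ∀ β : ℝ, β₀ ≤ β → mixSet ρ β n ε = ∅ ∧ mixOnset ρ β n ε = 0 := by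
  obtain ⟨δ, β₀, hwire⟩ := hW
  have hε3 : ε < 1 / 3 := eps_lt_third_of_admissible hM
  refine ⟨β₀, fun β hβ => ?_⟩
  have hempty : mixSet ρ β n ε = ∅ := by
    ext b
    simp only [Set.mem_empty_iff_false, iff_false]
    intro hb
    exact not_univShellCond_of_wireAt (hwire β hβ b hb.1 n hn) hε3 hb.2
  refine ⟨hempty, ?_⟩
  unfold mixOnset
  rw [hempty, Nat.sInf_empty]

/-- **`UniformWire r.ρ` refutes the g0 stub's conclusion at `(G, r)`** — for EVERY admissible `(n, ε)` no mesh mixes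
at large `β`; no `NT`, no unit map, no simplicity of `G` is used by the implication. -/
theorem onsetMixingAt_false_of_uniformWire (r : LatticeRep G) (hW : UniformWire r.ρ) :
    ¬ ∃ (n : ℕ) (ε : ℝ), 1 ≤ n ∧ 0 ≤ ε ∧ ε * shellCount n < 1 ∧
        ∃ β₂ : ℝ, ∀ β : ℝ, β₂ ≤ β → ∃ b : ℕ, 1 ≤ b ∧ UnivShellCond r.ρ β b n ε := by
  rintro ⟨n, ε, hn, -, hM, β₂, hon⟩
  obtain ⟨β₀, hempty⟩ := mixSet_eq_empty_of_uniformWire hW hn hM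
  obtain ⟨b, hb, hU⟩ := hon (max β₀ β₂) (le_max_right _ _)
  have hmem : b ∈ mixSet r.ρ (max β₀ β₂) n ε := ⟨hb, hU⟩
  rw [(hempty (max β₀ β₂) (le_max_left _ _)).1] at hmem
  exact hmem

end Wires

/-- **`UniformWire` for ONE lattice representation of ONE compact simple `G` refutes `OnsetMixing`** (the g0
stub quantifies over every compact simple `G` and every `r`). -/
theorem not_onsetMixing_of_uniformWire (G : Type) [Group G] [TopologicalSpace G] [IsTopologicalGroup G]
    [CompactSpace G] (hG : IsCompactSimpleLieGroup G)
    (hW : letI : MeasurableSpace G := borel G; haveI : BorelSpace G := ⟨rfl⟩;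
      ∃ r : LatticeRep G, UniformWire r.ρ) : ¬ OnsetMixing := by
  intro hI
  letI : MeasurableSpace G := borel G
  haveI : BorelSpace G := ⟨rfl⟩
  obtain ⟨r, hWr⟩ := hW
  exact onsetMixingAt_false_of_uniformWire r hWr (hI G hG r)

/-- `SU(2)` instance (compact simple by the tree's `isCompactSimpleLieGroup_specialUnitaryGroup`): a uniform wire for
any one lattice representation of `SU(2)` refutes the g0 stub.  This TYPES the g0 stub's bet: `¬ UniformWire r.ρ` for
every `r` of every compact simple `G`. -/
theorem not_onsetMixing_of_uniformWireSU2
    (hW : letI : MeasurableSpace (Matrix.specialUnitaryGroup (Fin 2) ℂ) :=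
        borel (Matrix.specialUnitaryGroup (Fin 2) ℂ);
      haveI : BorelSpace (Matrix.specialUnitaryGroup (Fin 2) ℂ) := ⟨rfl⟩;
      ∃ r : LatticeRep (Matrix.specialUnitaryGroup (Fin 2) ℂ), UniformWire r.ρ) : ¬ OnsetMixing :=
  not_onsetMixing_of_uniformWire _
    (isCompactSimpleLieGroup_specialUnitaryGroup isSimpleCompactGroup_specialUnitaryGroup_holds le_rfl) hW

/-- **certideate-2 g4's kill, kernel-checked modulo H:** the central-face wire for one lattice representation of
`SU(2)` (the card's instance: the fundamental, `ρ(−1) = −1`) refutes `OnsetMixing`. -/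
theorem not_onsetMixing_of_centralFaceWireSU2
    (hW : letI : MeasurableSpace (Matrix.specialUnitaryGroup (Fin 2) ℂ) :=
        borel (Matrix.specialUnitaryGroup (Fin 2) ℂ);
      haveI : BorelSpace (Matrix.specialUnitaryGroup (Fin 2) ℂ) := ⟨rfl⟩;
      ∃ r : LatticeRep (Matrix.specialUnitaryGroup (Fin 2) ℂ), CentralFaceWire r.ρ) : ¬ OnsetMixing := by
  refine not_onsetMixing_of_uniformWireSU2 ?_
  obtain ⟨r, hr⟩ := hW
  exact ⟨r, uniformWire_of_centralFaceWire hr⟩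

/-! ## §3 The card's symmetry lemma: central boundary data give a conjugation-invariant kernel (PROVED) -/

section Central

variable {G : Type} [Group G] [TopologicalSpace G] [IsTopologicalGroup G] [CompactSpace G]
  [MeasurableSpace G] [BorelSpace G]

/-- Boundary data CENTRAL off the resampled edge set `Λ`: every frozen link is in `Z(G)`. -/
def IsCentralOff (Λ : Finset (Literature.MathematicalPhysics.QuantumLattice.ZdEdge 4)) (η : LGConfig 4 G) : Prop :=
  ∀ e : Literature.MathematicalPhysics.QuantumLattice.ZdEdge 4, e ∉ Λ → η e ∈ Subgroup.center G

/-- Global conjugation `U ↦ h U h⁻¹` = the constant gauge transformation. -/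
def conjAll (h : G) : LGConfig 4 G → LGConfig 4 G :=
  gaugeTransformZd (fun _ => h)

/-- **Kernel symmetry (certideate-2 g4's first lemma; statement).**  With central frozen data the Wilson DLR kernel
on `Λ` is EXACTLY invariant under global conjugation: `(γ_Λ(·|η)).map (h · h⁻¹) = γ_Λ(·|η)`. -/
def CentralKernelInvariance {N : ℕ} (ρ : G →* Matrix (Fin N) (Fin N) ℂ) : Prop :=
  ∀ (β : ℝ) (Λ : Finset (Literature.MathematicalPhysics.QuantumLattice.ZdEdge 4)) (η : LGConfig 4 G),
    IsCentralOff Λ η → ∀ h : G, (ymSpecification ρ β Λ η).map (conjAll h) = ymSpecification ρ β Λ η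

omit [TopologicalSpace G] [IsTopologicalGroup G] [CompactSpace G] [MeasurableSpace G] [BorelSpace G] in
/-- Global conjugation fixes central data off `Λ` pointwise. -/
theorem conjAll_apply_of_isCentralOff {Λ : Finset (Literature.MathematicalPhysics.QuantumLattice.ZdEdge 4)}
    {η : LGConfig 4 G} (hη : IsCentralOff Λ η) (h : G)
    {e : Literature.MathematicalPhysics.QuantumLattice.ZdEdge 4} (he : e ∉ Λ) : conjAll h η e = η e := by
  have hc := Subgroup.mem_center_iff.mp (hη e he) h
  show h * η e * h⁻¹ = η e
  rw [hc, mul_inv_cancel_right]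

/-- **`CentralKernelInvariance` holds for every continuous `ρ` of a compact second-countable `G` (PROVED):** gauge
covariance of the Wilson specification (`ymSpecification_map_gaugeTransformZd_holds`) at the constant gauge function
`h` turns the push-forward into the kernel with exterior `h η h⁻¹`, which agrees with `η` off `Λ` (central data),
and the kernel reads its exterior only off `Λ` (`ymSpecification_congr_off`).  This is the exact symmetry a
frustrated central face would have to break spontaneously to be a wire. -/
theorem centralKernelInvariance [SecondCountableTopology G] {N : ℕ} {ρ : G →* Matrix (Fin N) (Fin N) ℂ}
    (hρ : Continuous ρ) : CentralKernelInvariance ρ := by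
  intro β Λ η hη h
  rw [conjAll, ymSpecification_map_gaugeTransformZd_holds ρ hρ β Λ η (fun _ => h)]
  exact ymSpecification_congr_off ρ β Λ fun e he => conjAll_apply_of_isCentralOff hη h he

end Central

end Summit.QuantumFields.YangMills.Cruxes.IR.OnsetWire

end
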